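import Mathlib.RingTheory.AlgebraicIndependent.TranscendenceBasis
import Mathlib.Algebra.Order.Antidiag.FinsuppEquiv
import Literature.Computability.AlgebraicComplexity.Yab15BRank
import HarnessLib

/-!
# Yabe 2015, §2.2 — the bi-polynomial rank of generic polynomials: Prop. 2.5 holds

Topic `Literature/Computability/AlgebraicComplexity`.  DISCHARGE of the named fact
`yabe2015_prop_2_5` of `Yab15BRank.lean` (A. Yabe, *Bi-polynomial rank and determinantal
complexity*, arXiv:1504.00151, Prop. 2.5, p0006:L27–L28):

  "For a polynomial `p ∈ ℂ[x]^{(2k)}` with algebraically independent coefficients over `ℚ`, it holds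
  that `brank(p) ≥ k!·D^k / (2·(2k)!)`."

typed (denominators cleared) as `k! · D^k ≤ 2 · (2k)! · bRank k p` for `p` homogeneous of degree
`2k` in `D = |σ|` variables whose coefficient vector `formCoeff (2k) p : 𝓘_{2k} → ℂ` is algebraically
independent over `ℚ`.

## The printed proof and the proof here

Printed (p0006:L30–L45): with `r := brank(p)` and `S_r := {q : brank(q) ≤ r} ⊆ ℂ^{s_{2k}}`,
Thm. 2.4 gives `dim S̄_r ≤ r(2s_k − r)`; `S̄_r` is defined over `ℚ` and `p ∈ S_r` has algebraically
independent coordinates over `ℚ`, so `S̄_r = ℂ^{s_{2k}}`, whence `r(2s_k − r) ≥ s_{2k}`, and then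
`r ≥ s_k − √(s_k² − s_{2k}) ≥ s_{2k}/(2 s_k) ≥ k!D^k/(2(2k)!)`.

Here the dimension comparison is done directly by TRANSCENDENCE DEGREE over `ℚ`, which is what
"`S̄_r` defined over `ℚ`, `p` generic ⇒ `dim S̄_r ≥ s_{2k}`" amounts to: an optimal decomposition
`p = Σ_{i<r} f_i g_i` (Def. 1.4; the infimum is attained, `exists_eq_sum_mul_of_isHomogeneous`)
places the `s_{2k}` coefficients of `p` — which are the sums `Σ_i Σ_{I+J=H} f_{i,I} g_{i,J}` of
the printed projection `π` (p0006:L6–L9) — inside the `ℚ`-subalgebra of `ℂ` generated by the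
`2·r·s_k` coefficients of the `f_i, g_i`, whose transcendence degree over `ℚ` is `≤ 2 r s_k`
(Mathlib: `trdeg` of a quotient of `ℚ[2 r s_k variables]`); an algebraically independent family in
it has at most that many members (`AlgebraicIndependent.cardinalMk_le_trdeg`), so
`s_{2k} ≤ 2 r s_k`.  This is the printed inequality `r ≥ s_{2k}/(2 s_k)` (the text's own chain only
uses `r(2s_k − r) ≤ 2 r s_k`; the sharper determinantal-variety dimension of Thm. 2.4 is not needed
for the printed constant).  Finally `s_j = C(D+j−1, j)` (Mathlib `Finset.card_finsuppAntidiag_nat_eq_choose`)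
and `(D+2k−1)!/(D+k−1)! ≥ D^k` give `k!·D^k ≤ 2·(2k)!·r` (`Yabe.factorial_mul_pow_le_of_choose_le`,
the printed last step `s_{2k}/(2s_k) ≥ k!D^k/(2(2k)!)`).

Everything is proved; no named facts, no new definitions.

## References

* [Yabe2015] A. Yabe, *Bi-polynomial rank and determinantal complexity*, arXiv:1504.00151 (2015):
  Def. 1.4 (p0003), §2.2 Thm. 2.4 (p0005:L133–L135), Prop. 2.5 and its proof (p0006:L27–L45),
  Prop. 2.6 (p0006:L50–L51).
-/

noncomputable section

open MvPolynomial Finset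

namespace Literature.Computability.AlgebraicComplexity

namespace Yabe

universe u v

/-! ### Step 1: the coefficients of `Σ f_i g_i` lie in the `ℚ`-algebra of the coefficients of the
`f_i, g_i` -/

section Coefficients

variable {σ : Type v} {k : ℕ}

/-- The coefficient of `x^H` in `Σ_i f_i g_i` is `Σ_i Σ_{I+J=H} f_{i,I} g_{i,J}` (the printed
projection `π`, p0006:L6–L9), hence lies in any subalgebra containing all coefficients of the
`f_i` and `g_i`. [cite: Yabe2015, Theorem 2.4 (proof, π)] -/
theorem coeff_sum_mul_mem {F : Type*} [CommRing F] [Algebra ℚ F] (A : Subalgebra ℚ F) {r : ℕ}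
    (f g : Fin r → MvPolynomial σ F) (hf : ∀ i I, coeff I (f i) ∈ A) (hg : ∀ i J, coeff J (g i) ∈ A)
    (H : σ →₀ ℕ) : coeff H (∑ i, f i * g i) ∈ A := by
  classical
  rw [coeff_sum]
  refine Subalgebra.sum_mem _ fun i _ => ?_
  rw [coeff_mul]
  exact Subalgebra.sum_mem _ fun x _ => Subalgebra.mul_mem _ (hf i x.1) (hg i x.2)

end Coefficients

/-! ### Step 2: transcendence degree — an algebraically independent family inside
`ℚ[t_1, …, t_N] ⊆ ℂ` has at most `N` members -/

section Trdeg

/-- If `x : ι → F` is algebraically independent over `ℚ` and every `x_i` lies in the `ℚ`-subalgebra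
generated by a finite family `T : τ → F`, then `|ι| ≤ |τ|` (`#ι ≤ trdeg_ℚ ℚ[T] ≤ trdeg_ℚ ℚ[X_τ] = |τ|`;
the step "`p` has no algebraic relation over `ℚ` in its coefficients ⇒ comparing the dimensions"
of the printed proof, p0006:L33–L36). [cite: Yabe2015, Proposition 2.5 (proof)] -/
theorem card_le_card_of_algebraicIndependent_of_mem_range {F : Type} [Field F] [Algebra ℚ F]
    {ι τ : Type} [Fintype ι] [Fintype τ] (x : ι → F) (hx : AlgebraicIndependent ℚ x) (T : τ → F)
    (hmem : ∀ i, x i ∈ (MvPolynomial.aeval T : MvPolynomial τ ℚ →ₐ[ℚ] F).range) :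
    Fintype.card ι ≤ Fintype.card τ := by
  classical
  set A : Subalgebra ℚ F := (MvPolynomial.aeval T : MvPolynomial τ ℚ →ₐ[ℚ] F).range with hA
  let x' : ι → A := fun i => ⟨x i, hmem i⟩
  have hx' : AlgebraicIndependent ℚ x' := AlgebraicIndependent.of_comp A.val hx
  have h1 : Cardinal.mk ι ≤ Algebra.trdeg ℚ A := hx'.cardinalMk_le_trdeg
  have h2 : Algebra.trdeg ℚ A ≤ Algebra.trdeg ℚ (MvPolynomial τ ℚ) :=
    trdeg_le_of_surjective
      ((MvPolynomial.aeval T : MvPolynomial τ ℚ →ₐ[ℚ] F).rangeRestrict)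
      (AlgHom.rangeRestrict_surjective _)
  have h3 : Algebra.trdeg ℚ (MvPolynomial τ ℚ) = Cardinal.mk τ := by
    rw [MvPolynomial.trdeg_of_isDomain, Cardinal.lift_id]
  have h := (h1.trans h2).trans_eq h3
  rwa [Cardinal.mk_fintype, Cardinal.mk_fintype, Nat.cast_le] at h

end Trdeg

/-! ### Step 3: the arithmetic `s_{2k} ≤ 2 r s_k ⇒ k! D^k ≤ 2 (2k)! r` -/

section Arithmetic

/-- `s_j = |𝓘_{j,D}| = C(D+j−1, j)` (Prop. 2.6's count; Mathlib's stars and bars).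
[cite: Yabe2015, Proposition 2.6] -/
theorem card_degMonomials_eq_choose (σ : Type v) [Fintype σ] [DecidableEq σ] (j : ℕ) :
    (degMonomials σ j).card = (Fintype.card σ + j - 1).choose j := by
  rw [degMonomials, Finset.card_finsuppAntidiag_nat_eq_choose, Finset.card_univ]

/-- The last printed step `s_{2k}/(2 s_k) ≥ k!·D^k/(2·(2k)!)` (p0006:L40–L43), cleared of
denominators: from `C(D+2k−1, 2k) ≤ 2·r·C(D+k−1, k)` infer `k!·D^k ≤ 2·(2k)!·r`
(`C(D+2k−1,2k)·(2k)!·(D−1)! = (D+2k−1)!`, `C(D+k−1,k)·k!·(D−1)! = (D+k−1)!`,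
`(D+k−1)!·D^k ≤ (D+2k−1)!`). [cite: Yabe2015, Proposition 2.5 (proof)] -/
theorem factorial_mul_pow_le_of_choose_le {D k r : ℕ}
    (h : (D + 2 * k - 1).choose (2 * k) ≤ 2 * r * (D + k - 1).choose k) :
    k.factorial * D ^ k ≤ 2 * (2 * k).factorial * r := by
  rcases Nat.eq_zero_or_pos D with rfl | hD
  · -- no variables
    rcases Nat.eq_zero_or_pos k with rfl | hk
    · simp at h ⊢; omega
    · rw [zero_pow (by omega), mul_zero]; exact Nat.zero_le _
  obtain ⟨d, rfl⟩ : ∃ d, D = d + 1 := ⟨D - 1, by omega⟩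
  have e2 : d + 1 + 2 * k - 1 = d + 2 * k := by omega
  have e1 : d + 1 + k - 1 = d + k := by omega
  rw [e2, e1] at h
  -- the two factorial identities
  have h2 : (d + 2 * k).choose (2 * k) * (2 * k).factorial * d.factorial = (d + 2 * k).factorial := by
    have := Nat.choose_mul_factorial_mul_factorial (n := d + 2 * k) (k := 2 * k) (by omega)
    rwa [show d + 2 * k - 2 * k = d by omega] at this
  have h1 : (d + k).choose k * k.factorial * d.factorial = (d + k).factorial := by
    have := Nat.choose_mul_factorial_mul_factorial (n := d + k) (k := k) (by omega)
    rwa [show d + k - k = d by omega] at this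
  -- `(d+k)! (d+1)^k ≤ (d+2k)!`
  have h3 : (d + k).factorial * (d + 1) ^ k ≤ (d + 2 * k).factorial := by
    calc (d + k).factorial * (d + 1) ^ k ≤ (d + k).factorial * (d + k + 1) ^ k :=
          Nat.mul_le_mul_left _ (Nat.pow_le_pow_left (by omega) _)
      _ ≤ (d + k + k).factorial := Nat.factorial_mul_pow_le_factorial
      _ = (d + 2 * k).factorial := by rw [two_mul, add_assoc]
  -- multiply the hypothesis by `(2k)! k! d!`
  have h4 : k.factorial * (d + 2 * k).factorial ≤ 2 * r * (2 * k).factorial * (d + k).factorial := by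
    have := Nat.mul_le_mul_right ((2 * k).factorial * d.factorial * k.factorial) h
    calc k.factorial * (d + 2 * k).factorial
        = (d + 2 * k).choose (2 * k) * ((2 * k).factorial * d.factorial * k.factorial) := by
          rw [← h2]; ring
      _ ≤ 2 * r * (d + k).choose k * ((2 * k).factorial * d.factorial * k.factorial) := this
      _ = 2 * r * (2 * k).factorial * ((d + k).choose k * k.factorial * d.factorial) := by ring
      _ = 2 * r * (2 * k).factorial * (d + k).factorial := by rw [h1]
  have h5 : k.factorial * (d + 1) ^ k * (d + k).factorial ≤
      2 * (2 * k).factorial * r * (d + k).factorial := by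
    calc k.factorial * (d + 1) ^ k * (d + k).factorial
        = k.factorial * ((d + k).factorial * (d + 1) ^ k) := by ring
      _ ≤ k.factorial * (d + 2 * k).factorial := Nat.mul_le_mul_left _ h3
      _ ≤ 2 * r * (2 * k).factorial * (d + k).factorial := h4
      _ = 2 * (2 * k).factorial * r * (d + k).factorial := by ring
  exact Nat.le_of_mul_le_mul_right h5 (Nat.factorial_pos _)

end Arithmetic

/-! ### Step 4: `s_{2k} ≤ 2 · brank(p) · s_k` for a polynomial with algebraically independent
coefficients -/

section Generic

variable {σ : Type v} [Fintype σ] [DecidableEq σ]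

/-- **The dimension comparison of Prop. 2.5** (p0006:L33–L43, "`r(2s_k − r) ≥ s_{2k}` … hence
`r ≥ s_{2k}/(2 s_k)`"): for `p ∈ ℂ[x]^{(2k)}` with algebraically independent coefficients over `ℚ`,
`s_{2k} ≤ 2 · brank(p) · s_k`. [cite: Yabe2015, Proposition 2.5 (proof)] -/
theorem card_degMonomials_le_two_mul_bRank_mul {k : ℕ} {p : MvPolynomial σ ℂ}
    (hp : p.IsHomogeneous (2 * k)) (hind : AlgebraicIndependent ℚ (formCoeff (2 * k) p)) :
    (degMonomials σ (2 * k)).card ≤ 2 * bRank k p * (degMonomials σ k).card := by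
  classical
  -- an optimal decomposition `p = Σ_{i < r} f_i g_i`, `r = brank(p)`
  obtain ⟨f, g, hf, hg, hpfg⟩ := exists_eq_sum_mul_of_isHomogeneous hp
  -- index the monomials by `Fin`
  let e₁ : DegIdx σ k ≃ Fin (Fintype.card (DegIdx σ k)) := Fintype.equivFin _
  let e₂ : DegIdx σ (2 * k) ≃ Fin (Fintype.card (DegIdx σ (2 * k))) := Fintype.equivFin _
  -- the `2 r s_k` coefficients of the decomposition
  let T : (Fin (bRank k p) × Fin (Fintype.card (DegIdx σ k))) ⊕
      (Fin (bRank k p) × Fin (Fintype.card (DegIdx σ k))) → ℂ := fun t =>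
    match t with
    | Sum.inl ia => coeff (e₁.symm ia.2).1 (f ia.1)
    | Sum.inr ia => coeff (e₁.symm ia.2).1 (g ia.1)
  let A : Subalgebra ℚ ℂ := (MvPolynomial.aeval T : MvPolynomial _ ℚ →ₐ[ℚ] ℂ).range
  have hT : ∀ t, T t ∈ A := fun t => (AlgHom.mem_range _).2 ⟨X t, MvPolynomial.aeval_X T t⟩
  -- every coefficient of every `f_i`, `g_i` lies in `A` (it is a `T`-value or `0`)
  have hcoeff : ∀ (q : MvPolynomial σ ℂ), q.IsHomogeneous k →
      ∀ (c : Fin (Fintype.card (DegIdx σ k)) → ℂ), (∀ a, c a = coeff (e₁.symm a).1 q) →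
      (∀ a, c a ∈ A) → ∀ I, coeff I q ∈ A := by
    intro q hq c hc hcA I
    by_cases hI : I.degree = k
    · have hmem : I ∈ degMonomials σ k := mem_degMonomials_iff.2 hI
      have : coeff I q = c (e₁ ⟨I, hmem⟩) := by rw [hc, Equiv.symm_apply_apply]
      rw [this]; exact hcA _
    · rw [hq.coeff_eq_zero hI]; exact zero_mem A
  have hfA : ∀ i I, coeff I (f i) ∈ A := fun i =>
    hcoeff (f i) (hf i) (fun a => T (Sum.inl (i, a))) (fun _ => rfl) (fun a => hT (Sum.inl (i, a)))
  have hgA : ∀ i J, coeff J (g i) ∈ A := fun i =>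
    hcoeff (g i) (hg i) (fun a => T (Sum.inr (i, a))) (fun _ => rfl) (fun a => hT (Sum.inr (i, a)))
  -- hence so does every coefficient of `p`
  have hpA : ∀ H, coeff H p ∈ A := fun H => by
    rw [hpfg]; exact coeff_sum_mul_mem A f g hfA hgA H
  -- the algebraically independent coefficient family, indexed by `Fin s_{2k}`
  have hind' : AlgebraicIndependent ℚ (formCoeff (2 * k) p ∘ e₂.symm) :=
    hind.comp _ e₂.symm.injective
  have hmem : ∀ a, (formCoeff (2 * k) p ∘ e₂.symm) a ∈ A := fun a => by
    simp only [Function.comp_apply, formCoeff_apply]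
    exact hpA _
  have hle := card_le_card_of_algebraicIndependent_of_mem_range _ hind' T hmem
  simp only [Fintype.card_fin, Fintype.card_sum, Fintype.card_prod] at hle
  -- `s_{2k} ≤ r s_k + r s_k`
  rw [← Fintype.card_coe (degMonomials σ (2 * k)), ← Fintype.card_coe (degMonomials σ k)]
  calc Fintype.card (DegIdx σ (2 * k))
      ≤ bRank k p * Fintype.card (DegIdx σ k) + bRank k p * Fintype.card (DegIdx σ k) := hle
    _ = 2 * bRank k p * Fintype.card (DegIdx σ k) := by ring

end Generic

end Yabe

/-! ## The named fact holds -/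

/-- **Yabe 2015, Proposition 2.5 — DISCHARGED** (p0006:L27–L28): for `p ∈ ℂ[x]^{(2k)}` with
algebraically independent coefficients over `ℚ`, `brank(p) ≥ k!·D^k / (2·(2k)!)`, i.e.
`k!·D^k ≤ 2·(2k)!·brank(p)` (`D = |σ|`).  Proof: `s_{2k} ≤ 2·brank(p)·s_k` by transcendence degree
(`Yabe.card_degMonomials_le_two_mul_bRank_mul`), `s_j = C(D+j−1, j)`, and the printed estimate
`s_{2k}/(2s_k) ≥ k!D^k/(2(2k)!)` (`Yabe.factorial_mul_pow_le_of_choose_le`).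
[cite: Yabe2015, Proposition 2.5] -/
theorem yabe2015_prop_2_5_holds : yabe2015_prop_2_5 := by
  intro σ _ _ k p hp hind
  have h := Yabe.card_degMonomials_le_two_mul_bRank_mul hp hind
  rw [Yabe.card_degMonomials_eq_choose, Yabe.card_degMonomials_eq_choose] at h
  exact Yabe.factorial_mul_pow_le_of_choose_le h

end Literature.Computability.AlgebraicComplexity
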